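import Summits.BirchSwinnertonDyer.Rank1Residual.Ordinary.FormalFiltrationDivisibility
import Literature.NumberTheory.EllipticCurves.ComplexMultiplicationCoatesWilesReductionIndexProofs
import Literature.NumberTheory.EllipticCurves.AnomalousOfRationalTorsionProofs
import Summits.BirchSwinnertonDyer.Rank1Residual.O5.SignedLevelRaisingTransferThree
import HarnessLib

/-!
# `p`-divisibility of a local point is read on the formal group: `P ∈ p^j E(ℚ_p) ⟺ #Ẽ(𝔽_p)·P ∈ E⁽ʲ⁺¹⁾`
# at a good non-anomalous odd `p` — so C-16's clause `m₃(P) = 0` is «`#Ẽ(𝔽₃)·P` has formal level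
# exactly `1`», the instruments' `m_p = (level of #Ẽ(𝔽_p)·P) − 1` (PROVED)

HONEST FRAMING (cell `b2b-bsdres`, run/shared/lean/b2b/bsd-rank1-residual/, verbatim in every
file): the goal of the cell is to DELETE the COMBINATION-SHAPED residual classes of the
Birch–Swinnerton-Dyer formula for ALL analytic-rank `≤ 1` elliptic curves over `ℚ` — "full BSD
formula for every rank `≤ 1` curve in class `C`" assembled STRICTLY from published theorems — so
that the rank-`≤ 1` remainder becomes exactly the CONSTRUCTION-SHAPED classes, which are TYPED
(missing-input `Prop`s), NOT attempted. This is not "finishing BSD". Seat `b2b-bsdres-additive-p3`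
(typer-designate for the cell conjecture C-16, hyp R-16 (e)). THEOREMS ONLY (no definition, no named
fact) about `E(ℚ_p)` of an elliptic curve over `ℚ` at a good prime `p`, and their reading on the
`m₃(P) = 0` clause `¬ O5.PointLocallyThreeDivisibleAt W 3 P` of the typed conjecture C-16 = hyp §120 C120.1
(`Ordinary/Conjectures/KuriharaExactOrderRankOneAt3.lean`). Nothing about any particular curve is asserted,
nothing is booked, no mark / label / count / tier moves; C-16 stays a CONJECTURE (data-suggested, never
theorem). Local theory: sibling `Ordinary/FormalFiltrationDivisibility.lean` (`E⁽ᵏ⁺¹⁾ = p·E⁽ᵏ⁾`, `k ≥ 1`,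
`p` odd; the `n`-trick).

## Why this file

C-16's letter carries `m₃(P) := v₃[E(ℚ₃) ⊗ ℤ₃ : ℤ₃·P] = 0`, typed as "`P ∉ 3·E(ℚ₃)`"
(`¬ O5.PointLocallyThreeDivisibleAt W 3 P`); C-17 = C120.2 drops the clause, and the P-5 instruments
(`HOME/b2b-bsdres-additive-p3/R1-DEPTH-LAW.md` §1) COMPUTE `m_p` as "the formal-group level of
`#Ẽ(𝔽_p)·P` minus `1`" (ROUND 10 (C), ROUND 15 arm C17: the `m₃ ≥ 1` strata). The sibling
`Ordinary/LocalDivExponentPointOrder.lean` proved the first half of the faithfulness remark behind the clause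
(`E(ℚ₃)[3^∞] = 0` at a good non-anomalous `3`); this file proves the second half, at every odd good
non-anomalous `p`: divisibility by `p^j` in `E(ℚ_p)` is decided in the formal group.

## What is proved (`W/ℚ` globally minimal elliptic, `p` prime)

* `p` odd, `p ∤ Δ_min(E)`, `p ∤ #Ẽ(𝔽_p)`: for EVERY `P ∈ E(ℚ_p)` and every `j`,
  **`(∃ Q ∈ E(ℚ_p), p^j·Q = P) ⟺ #Ẽ(𝔽_p)·P ∈ E⁽ʲ⁺¹⁾(ℚ_p)`** (`‖z(#Ẽ(𝔽_p)·P)‖ ≤ p^{−(j+1)}`), i.e.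
  `m_p(P) = (level of #Ẽ(𝔽_p)·P) − 1` (`#Ẽ(𝔽_p)·E(ℚ_p) ⊆ E₁(ℚ_p)` by AEC VII.2.1, tree
  `isInReductionKernel_reductionPointCount_nsmul`, and the sibling's `n`-trick);
* any good `p`: a point `p^j`-divisible for every `j` is killed by `#Ẽ(𝔽_p)` (tree
  `eq_zero_of_forall_exists_p_pow_nsmul_eq`), so a point of infinite order is NOT infinitely
  `p`-divisible — the letter's `m₃(P)` is a NUMBER for the generator `P`;
* `p = 3` good non-anomalous (`a₃ ∉ {1, −2}` ⟺ `3 ∤ #Ẽ(𝔽₃)`, from `1 ≤ #Ẽ(𝔽₃) ≤ 7`):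
  **`PointLocallyThreeDivisibleAt W 3 P ⟺ #Ẽ(𝔽₃)·P ∈ E⁽²⁾(ℚ₃)`** and
  **`¬ PointLocallyThreeDivisibleAt W 3 P ⟺ ‖z(#Ẽ(𝔽₃)·P)‖ = 3⁻¹`** — the instruments' ONE formal-group
  evaluation computes the typed clause.

References: J. H. Silverman, AEC 2nd ed. (2009), IV.3.2 (a), IV.6.4 (b), VII.2.1, VII.2.2
[SilvermanAEC2009]; hyp `SHARPENED-CONJECTURES.md` §120 C120.1 / C120.2; additive-p3 `R1-DEPTH-LAW.md`
§1–§2 (`m_p`), §5.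
-/

noncomputable section

open scoped Classical

open WeierstrassCurve Literature.NumberTheory.EllipticCurves

namespace Summit.BirchSwinnertonDyer.Rank1Residual.Ordinary

/-! ### Divisibility in `E(ℚ_p)` at a good non-anomalous odd `p`; the `m₃(P) = 0` clause of C-16 -/

section Global

variable (W : WeierstrassCurve ℚ) [W.IsElliptic] [W.IsGloballyMinimal] (p : ℕ) [Fact p.Prime]

/-- **`P ∈ p^j·E(ℚ_p) ⟺ #Ẽ(𝔽_p)·P ∈ E⁽ʲ⁺¹⁾(ℚ_p)`** for every `P ∈ E(ℚ_p)`, at an odd prime `p ∤ Δ_min(E)`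
(good) with `p ∤ #Ẽ(𝔽_p)` (non-anomalous): `#Ẽ(𝔽_p)·E(ℚ_p) ⊆ E₁(ℚ_p)` (AEC VII.2.1, tree
`isInReductionKernel_reductionPointCount_nsmul`) and the sibling's `n`-trick
`exists_pow_smul_eq_iff_nsmul_mem_formalFiltration`. So **`m_p(P) = (formal level of #Ẽ(𝔽_p)·P) − 1`**
— the P-5 instruments' recipe for `m_p := v_p[E(ℚ_p) ⊗ ℤ_p : ℤ_p·P]` (`R1-DEPTH-LAW.md` §1), now a
theorem about divisibility in `E(ℚ_p)`. [cite: SilvermanAEC2009, IV.6.4 (b) and VII.2.1] -/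
theorem exists_pow_smul_eq_iff_reductionPointCount_nsmul_mem_formalFiltration (hp2 : p ≠ 2)
    (hgood : ¬ (p : ℤ) ∣ minimalDiscriminantInt W) (hna : ¬ p ∣ W.reductionPointCount p)
    (P : (W.baseChange ℚ_[p]).toAffine.Point) (j : ℕ) :
    (∃ Q : (W.baseChange ℚ_[p]).toAffine.Point, p ^ j • Q = P) ↔
      W.reductionPointCount p • P ∈ (W.baseChange ℚ_[p]).formalFiltration (j + 1) :=
  exists_pow_smul_eq_iff_nsmul_mem_formalFiltration (W.baseChange ℚ_[p]) hp2 hna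
    (W.isInReductionKernel_reductionPointCount_nsmul p hgood) P j

/-- **A point of `E(ℚ_p)` that is `p^j`-divisible for every `j` is killed by `#Ẽ(𝔽_p)`** (any good `p`):
`#Ẽ(𝔽_p)·P ∈ p^j·E₁ ⊆ E⁽ʲ⁾` for all `j` forces `z = 0` (tree `eq_zero_of_forall_exists_p_pow_nsmul_eq`,
AEC IV.3.2). Hence a point of infinite order is `p^j`-divisible for only finitely many `j`: the letter's
`m₃(P)` (C-16 / C-17) is a NUMBER for the generator `P`. [cite: SilvermanAEC2009, IV.3.2 (a) and VII.2.1] -/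
theorem reductionPointCount_nsmul_eq_zero_of_forall_exists_pow_smul_eq
    (hgood : ¬ (p : ℤ) ∣ minimalDiscriminantInt W) (P : (W.baseChange ℚ_[p]).toAffine.Point)
    (h : ∀ j : ℕ, ∃ Q : (W.baseChange ℚ_[p]).toAffine.Point, p ^ j • Q = P) :
    W.reductionPointCount p • P = 0 := by
  refine (W.baseChange ℚ_[p]).eq_zero_of_forall_exists_p_pow_nsmul_eq
    (W.isInReductionKernel_reductionPointCount_nsmul p hgood P) fun j => ?_
  obtain ⟨Q, hQ⟩ := h (j + 1)
  exact ⟨W.reductionPointCount p • Q, W.isInReductionKernel_reductionPointCount_nsmul p hgood Q,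
    by rw [smul_comm, hQ]⟩

/-- So **a point of infinite order of `E(ℚ_p)` is NOT infinitely `p`-divisible** at a good `p`:
`∃ j, P ∉ p^j·E(ℚ_p)`. [cite: SilvermanAEC2009, IV.3.2 (a) and VII.2.1] -/
theorem exists_not_exists_pow_smul_eq_of_not_isOfFinAddOrder
    (hgood : ¬ (p : ℤ) ∣ minimalDiscriminantInt W) (P : (W.baseChange ℚ_[p]).toAffine.Point)
    (hP : ¬ IsOfFinAddOrder P) :
    ∃ j : ℕ, ¬ ∃ Q : (W.baseChange ℚ_[p]).toAffine.Point, p ^ j • Q = P := by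
  by_contra hall
  have hall' : ∀ j : ℕ, ∃ Q : (W.baseChange ℚ_[p]).toAffine.Point, p ^ j • Q = P :=
    fun j => not_not.mp (not_exists.mp hall j)
  have h0 := reductionPointCount_nsmul_eq_zero_of_forall_exists_pow_smul_eq W p hgood P hall'
  have hn : 0 < W.reductionPointCount p := by
    rw [reductionPointCount]
    exact Nat.card_pos
  exact hP (isOfFinAddOrder_iff_nsmul_eq_zero.mpr ⟨W.reductionPointCount p, hn, h0⟩)

omit [W.IsElliptic] in
/-- `#Ẽ(𝔽₃) ∈ [1, 7]`, `a₃ = 4 − #Ẽ(𝔽₃)`: the letter's "non-anomalous" clause `a₃ ∉ {1, −2}` gives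
`3 ∤ #Ẽ(𝔽₃)`. [folklore] -/
private theorem not_three_dvd_reductionPointCount (ha1 : W.frobeniusTrace 3 ≠ 1)
    (ha2 : W.frobeniusTrace 3 ≠ -2) : ¬ 3 ∣ W.reductionPointCount 3 := by
  haveI : Fact (Nat.Prime 3) := ⟨Nat.prime_three⟩
  have hN : W.reductionPointCount 3 ≤ 2 * 3 + 1 := by
    have h := natCard_point_le_two_mul_card_add_one
      ((integralModelInt W).map (Int.castRingHom (ZMod 3)))
    rwa [ZMod.card] at h
  have hN1 : 1 ≤ W.reductionPointCount 3 := by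
    rw [reductionPointCount]
    exact Nat.card_pos
  have ha : W.frobeniusTrace 3 = (3 : ℕ) + 1 - (W.reductionPointCount 3 : ℤ) := rfl
  push_cast at ha
  omega

/-- **C-16's `m₃(P) = 0` clause read on the formal group.** At a good non-anomalous `3` (`a₃ ∉ {1, −2}`),
for every rational point `P`: **`PointLocallyThreeDivisibleAt W 3 P ⟺ #Ẽ(𝔽₃)·P ∈ E⁽²⁾(ℚ₃)`**, i.e.
`P ∈ 3·E(ℚ₃) ⟺ ‖z(#Ẽ(𝔽₃)·P)‖ ≤ 3⁻²`. With `E(ℚ₃)[3^∞] = 0` (sibling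
`forall_pow_three_nsmul_eq_zero_padic_of_frobeniusTrace_three`) and `E⁽¹⁾ ≅ ℤ₃` (this file's §1 in
divisibility form) this is the faithfulness of the typed clause to hyp §120's
`m₃(P) := v₃[E(ℚ₃) ⊗ ℤ₃ : ℤ₃·P] = 0`. [cite: SilvermanAEC2009, IV.6.4 (b) and VII.2.1] -/
theorem pointLocallyThreeDivisibleAt_iff_nsmul_mem_formalFiltration_two
    (hgood : W.HasGoodReductionAtPrime 3) (ha1 : W.frobeniusTrace 3 ≠ 1) (ha2 : W.frobeniusTrace 3 ≠ -2)
    (P : W.toAffine.Point) :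
    O5.PointLocallyThreeDivisibleAt W 3 P ↔
      W.reductionPointCount 3 • Affine.Point.map (W' := W.toAffine) (Algebra.ofId ℚ ℚ_[3]) P ∈
        (W.baseChange ℚ_[3]).formalFiltration 2 := by
  have hΔ := not_dvd_minimalDiscriminantInt_of_hasGoodReductionAtPrime' W 3 hgood
  have hna := not_three_dvd_reductionPointCount W ha1 ha2
  have h := exists_pow_smul_eq_iff_reductionPointCount_nsmul_mem_formalFiltration W 3 (by norm_num)
    hΔ hna (Affine.Point.map (W' := W.toAffine) (Algebra.ofId ℚ ℚ_[3]) P) 1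
  rw [pow_one] at h
  rw [← h]
  exact ⟨fun ⟨Q, hQ⟩ => ⟨Q, hQ.symm⟩, fun ⟨Q, hQ⟩ => ⟨Q, hQ.symm⟩⟩

/-- **`m₃(P) = 0` ⟺ `#Ẽ(𝔽₃)·P` has formal level EXACTLY `1`: `¬ PointLocallyThreeDivisibleAt W 3 P ⟺
‖z(#Ẽ(𝔽₃)·P)‖ = 3⁻¹`** at a good non-anomalous `3` (`#Ẽ(𝔽₃)·P ∈ E₁(ℚ₃)` always, so `‖z‖ ≤ 3⁻¹`; norms
on `ℚ₃` are powers of `3`) — the instruments' ONE formal-group evaluation computes the typed clause.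
[cite: SilvermanAEC2009, IV.6.4 (b) and VII.2.1] -/
theorem not_pointLocallyThreeDivisibleAt_iff_norm_formalParameter_eq
    (hgood : W.HasGoodReductionAtPrime 3) (ha1 : W.frobeniusTrace 3 ≠ 1) (ha2 : W.frobeniusTrace 3 ≠ -2)
    (P : W.toAffine.Point) :
    ¬ O5.PointLocallyThreeDivisibleAt W 3 P ↔
      ‖(W.baseChange ℚ_[3]).formalParameter
          (W.reductionPointCount 3 • Affine.Point.map (W' := W.toAffine) (Algebra.ofId ℚ ℚ_[3]) P)‖ =
        ((3 : ℕ) : ℝ)⁻¹ := by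
  have hΔ := not_dvd_minimalDiscriminantInt_of_hasGoodReductionAtPrime' W 3 hgood
  set R := W.reductionPointCount 3 • Affine.Point.map (W' := W.toAffine) (Algebra.ofId ℚ ℚ_[3]) P
    with hRdef
  have hker : (W.baseChange ℚ_[3]).IsInReductionKernel R :=
    W.isInReductionKernel_reductionPointCount_nsmul 3 hΔ _
  have hle : ‖(W.baseChange ℚ_[3]).formalParameter R‖ ≤ ((3 : ℕ) : ℝ)⁻¹ :=
    (W.baseChange ℚ_[3]).norm_formalParameter_le_inv hker
  have hlt := padicNorm_lt_inv_pow_iff_le ((W.baseChange ℚ_[3]).formalParameter R) 1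
  rw [pow_one] at hlt
  rw [pointLocallyThreeDivisibleAt_iff_nsmul_mem_formalFiltration_two W hgood ha1 ha2 P, ← hRdef,
    mem_formalFiltration_iff]
  constructor
  · intro h
    have h2 : ¬ ‖(W.baseChange ℚ_[3]).formalParameter R‖ ≤ (((3 : ℕ) : ℝ)⁻¹) ^ (1 + 1) :=
      fun hle2 => h ⟨hker, hle2⟩
    exact le_antisymm hle (not_lt.mp fun hl => h2 (hlt.mp hl))
  · rintro heq ⟨-, hle2⟩
    have hl := hlt.mpr hle2
    rw [heq] at hl
    exact lt_irrefl _ hl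

end Global

end Summit.BirchSwinnertonDyer.Rank1Residual.Ordinary

end
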